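import Literature.NumberTheory.Rogawski1990.ArchimedeanTransfer          -- ★ `endoEmbArch`, `coe_endoEmbArch`; `UnitaryGroup.arch`, `UnitaryGroup.evalC`
import Literature.NumberTheory.Rogawski1990.EndoscopicClassTransfer      -- ★ `charpoly_endoGL`
import Literature.LinearAlgebra.Matrix.RegularSemisimpleConjClassClosed  -- ★ `Literature.LinearAlgebra.Matrix.continuous_charpoly_coeff`
import Mathlib.Analysis.Polynomial.CauchyBound
import HarnessLib

/-!
# Eigenvalue bound along the endoscopic norm correspondence at `∞`: `ι_∞(γ_H)` conjugate into a compact of `GL₃(L ⊗ ℝ)` ⇒ the eigenvalues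
# of `γ_H` at every complex place are uniformly bounded (organ (EIG-bridge) of the `stub_N9` pay-down line, LH3)

Topic `NumberTheory/Rogawski1990`; namespace `Literature.NumberTheory.Rogawski1990`.  THEOREMS ONLY (no definition, no instance, no notation, no named
fact, no `sorry`).  Cell `pub/hodgecm-mathlib`, F0∕P3c line LH3 (closer stub `stub_N9` of `Cruxes/H413/Lines/F0_U3LettersRung1.lean`, crux H413 =
`stmt-HodgeConjecture-24833`); seat LH3-p02 (g0), deal #2 of LH3-plan (g0) 02:27Z; lane `--supports stmt-HodgeConjecture-24833`.  HONEST LABEL: HC_CM is proved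
only modulo the 7 printed citations (2 remaining: hLiu418 = stmt-HodgeConjecture-24832, h413 = stmt-HodgeConjecture-24833) until rung 0 closes; this file is
linear-algebra bookkeeping and pays no printed statement by itself.

THE MATHEMATICS (the «conjugacy ⇒ eigenvalue» half of organ (EIG→CPT) of `F0_P3c_StubN9Paydown`; the «eigenvalue ⇒ compact torus piece» half is LH3-p03's
`ArchEndoscopicEigenvalueCompact`).  Let `K ⊆ GL₃(L ⊗ ℝ)` be compact and `γ_H = (g, u) ∈ H_∞ = U(Φ₂)(L⁺ ⊗ ℝ) × U(Φ₁)(L⁺ ⊗ ℝ)` with `ι_∞(γ_H)` conjugate in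
`GL₃(L ⊗ ℝ)` to some `k ∈ K`.  Conjugate matrices have the same characteristic polynomial (Mathlib `Matrix.charpoly_units_conj`), `ι_∞(γ_H) = endoGL(g, u)`
(★ `coe_endoEmbArch`) has `charpoly = charpoly g · charpoly u` (★ `charpoly_endoGL`), and both facts survive the evaluation `L ⊗ ℝ → ℂ` at a complex place `w`
(★ `map_endoGL`, Mathlib `Matrix.charpoly_map`): `charpoly g_w ∣ charpoly k_w`.  By Cauchy's bound (Mathlib `Polynomial.IsRoot.norm_lt_cauchyBound`; `charpoly k_w`
is monic) every root `z` of `charpoly k_w` has `‖z‖ ≤ 1 + Σ_{i<3} ‖coeff_i(charpoly k_w)‖`, a continuous function of `k` (★ `continuous_charpoly_coeff`), hence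
bounded on `K` uniformly in `w` (finitely many places).  [Rogawski1990, §4.3 p. 42 («`γ ∈ H` is `G`-regular if …»: the class of `ι(γ_H)` is read through its
characteristic polynomial); §14.3 p. 234] [Shelstad2012, proof of Cor. 2.2 p. 1926: «the stable orbital integrals … vanish off the conjugacy classes meeting a set
… bounded modulo `Z₁(ℝ)`»].
* §1 `norm_le_sum_norm_coeff_add_one_of_isRoot` — roots of a monic polynomial over a normed field: `‖z‖ ≤ Σ_{i < deg} ‖aᵢ‖ + 1` (Cauchy).
* §2 `charpoly_map_evalC_eq_mul_of_isConj_endoEmbArch` — `charpoly k_w = charpoly g_w · charpoly u_w` for `ι_∞(g, u) ∼ k`.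
* §3 `exists_forall_norm_root_charpoly_le_of_isConj_endoEmbArch` — the uniform bound `R(K)` on the eigenvalues of `g_w` (the input of LH3-p03's radius-form
  head `exists_isCompact_isArchStablyConjH_of_charpoly_roots_norm_le`).

## References
* [Rogawski1990] J. D. Rogawski, *Automorphic Representations of Unitary Groups in Three Variables*, Ann. of Math. Stud. 123 (1990): §4.3 p. 42, §14.3 p. 234.
* [Shelstad2012] D. Shelstad, *On geometric transfer in real twisted endoscopy*, Ann. of Math. 176 (2012), proof of Cor. 2.2 p. 1926 (held
  `paper:doi-10-4007-annals-2012-176-3-9`, p0008).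
* [HornJohnson2013] R. A. Horn, C. R. Johnson, *Matrix Analysis*, 2nd ed., Thm. 1.2.16 (coefficients of the characteristic polynomial), §5.6 (spectral
  radius bounds).
-/

set_option autoImplicit false

noncomputable section

open NumberField Polynomial
open scoped Matrix MatrixGroups NNReal

namespace Literature.NumberTheory.Rogawski1990

open Literature.NumberTheory.Automorphic

/-! ## §1 Cauchy's bound for monic polynomials -/

/-- **Cauchy's root bound, monic form**: for a monic polynomial `p` over a normed field and a root `z`, `‖z‖ ≤ (Σ_{i < deg p} ‖pᵢ‖) + 1`
(Mathlib `Polynomial.IsRoot.norm_lt_cauchyBound`, with `sup ≤ sum` and leading coefficient `1`). [cite: HornJohnson2013, §5.6] -/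
theorem norm_le_sum_norm_coeff_add_one_of_isRoot {K : Type*} [NormedField K] {p : K[X]} (hp : p.Monic) {z : K} (hz : p.IsRoot z) :
    ‖z‖ ≤ (∑ i ∈ Finset.range p.natDegree, ‖p.coeff i‖) + 1 := by
  have h1 : ‖z‖₊ < p.cauchyBound := hz.norm_lt_cauchyBound hp.ne_zero
  have h2 : p.cauchyBound ≤ (∑ i ∈ Finset.range p.natDegree, ‖p.coeff i‖₊) + 1 := by
    unfold Polynomial.cauchyBound
    rw [hp.leadingCoeff, nnnorm_one, div_one]
    have hs : (Finset.range p.natDegree).sup (fun i => ‖p.coeff i‖₊) ≤ ∑ i ∈ Finset.range p.natDegree, ‖p.coeff i‖₊ :=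
      Finset.sup_le fun i hi => Finset.single_le_sum (f := fun j => ‖p.coeff j‖₊) (fun _ _ => zero_le) hi
    exact add_le_add hs le_rfl
  have h3 : ((‖z‖₊ : ℝ≥0) : ℝ) ≤ (((∑ i ∈ Finset.range p.natDegree, ‖p.coeff i‖₊) + 1 : ℝ≥0) : ℝ) :=
    NNReal.coe_le_coe.mpr (h1.le.trans h2)
  push_cast at h3
  exact h3

/-! ## §2 The characteristic polynomial along `ι_∞` and a conjugation, read at a complex place -/

section Arch

variable (L : Type) [Field L] [NumberField L] [IsCMField L]

/-- **`charpoly k_w = charpoly g_w · charpoly u_w` when `ι_∞(g, u)` is `GL₃(L ⊗ ℝ)`-conjugate to `k`**: conjugation does not change the characteristic polynomial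
(Mathlib `Matrix.charpoly_units_conj`), `ι_∞(g, u) = endoGL(g, u)` (★ `coe_endoEmbArch`) has `charpoly g · charpoly u` (★ `charpoly_endoGL`), and evaluation at
the complex place `w` (`GL₃(evalC w)`, ★ `map_endoGL`; Mathlib `Matrix.charpoly_map`) is a ring map. [cite: Rogawski1990, §4.3 p. 42] -/
theorem charpoly_map_evalC_eq_mul_of_isConj_endoEmbArch
    (γH : ↥(UnitaryGroup.arch (↥(maximalRealSubfield L)) L (IsCMField.complexConj L) 2
              (Matrix.of fun i j : Fin 2 => if i.val + j.val + 1 = 2 then (1 : L) else 0)) ×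
          ↥(UnitaryGroup.arch (↥(maximalRealSubfield L)) L (IsCMField.complexConj L) 1
              (Matrix.of fun i j : Fin 1 => if i.val + j.val + 1 = 1 then (1 : L) else 0)))
    {k : GL (Fin 3) (mixedEmbedding.mixedSpace L)}
    (hk : IsConj ((endoEmbArch L γH).val : GL (Fin 3) (mixedEmbedding.mixedSpace L)) k)
    (w : {w : InfinitePlace L // InfinitePlace.IsComplex w}) :
    ((Matrix.GeneralLinearGroup.map (UnitaryGroup.evalC L w) k : GL (Fin 3) ℂ) : Matrix (Fin 3) (Fin 3) ℂ).charpoly =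
      ((Matrix.GeneralLinearGroup.map (UnitaryGroup.evalC L w) (γH.1.val : GL (Fin 2) (mixedEmbedding.mixedSpace L)) : GL (Fin 2) ℂ) :
          Matrix (Fin 2) (Fin 2) ℂ).charpoly *
        ((Matrix.GeneralLinearGroup.map (UnitaryGroup.evalC L w) (γH.2.val : GL (Fin 1) (mixedEmbedding.mixedSpace L)) : GL (Fin 1) ℂ) :
          Matrix (Fin 1) (Fin 1) ℂ).charpoly := by
  -- transport the conjugation to the place `w`
  have hkw : IsConj (Matrix.GeneralLinearGroup.map (UnitaryGroup.evalC L w) ((endoEmbArch L γH).val : GL (Fin 3) (mixedEmbedding.mixedSpace L)))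
      (Matrix.GeneralLinearGroup.map (UnitaryGroup.evalC L w) k) :=
    (Matrix.GeneralLinearGroup.map (UnitaryGroup.evalC L w)).map_isConj hk
  obtain ⟨c, hc⟩ := isConj_iff.mp hkw
  rw [← hc, Units.val_mul, Units.val_mul, Matrix.coe_units_inv, Matrix.charpoly_units_conj, coe_endoEmbArch, map_endoGL,
    charpoly_endoGL]

/-! ## §3 The uniform eigenvalue bound -/

/-- **(EIG-bridge) UNIFORM EIGENVALUE BOUND ALONG THE NORM CORRESPONDENCE.**  For a compact `K ⊆ GL₃(L ⊗ ℝ)` there is `R` such that for every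
`γ_H = (g, u) ∈ H_∞` with `ι_∞(γ_H)` conjugate in `GL₃(L ⊗ ℝ)` to a point of `K`, every root `z` of the characteristic polynomial of `g_w = GL₂(evalC w) g` at
every complex place `w` satisfies `‖z‖ ≤ R` (`z` is a root of `charpoly k_w` by §2; Cauchy's bound §1 for the monic `charpoly k_w`; the bound
`k ↦ Σ_w (Σ_{i<3} ‖coeff_i(charpoly k_w)‖ + 1)` is continuous — ★ `continuous_charpoly_coeff` — hence bounded on `K`).  Consumed by LH3-p03's radius-form head
`exists_isCompact_isArchStablyConjH_of_charpoly_roots_norm_le`; `g_w` is spelled as the right-hand side of ★ `coe_archPiEquivCM_apply`.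
[cite: Rogawski1990, §4.3 p. 42; §14.3 p. 234] [cite: Shelstad2012, Cor. 2.2 p. 1926] -/
theorem exists_forall_norm_root_charpoly_le_of_isConj_endoEmbArch
    (K : Set (GL (Fin 3) (mixedEmbedding.mixedSpace L))) (hK : IsCompact K) :
    ∃ R : ℝ, ∀ γH : ↥(UnitaryGroup.arch (↥(maximalRealSubfield L)) L (IsCMField.complexConj L) 2
              (Matrix.of fun i j : Fin 2 => if i.val + j.val + 1 = 2 then (1 : L) else 0)) ×
          ↥(UnitaryGroup.arch (↥(maximalRealSubfield L)) L (IsCMField.complexConj L) 1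
              (Matrix.of fun i j : Fin 1 => if i.val + j.val + 1 = 1 then (1 : L) else 0)),
      (∃ k ∈ K, IsConj ((endoEmbArch L γH).val : GL (Fin 3) (mixedEmbedding.mixedSpace L)) k) →
        ∀ (w : {w : InfinitePlace L // InfinitePlace.IsComplex w}) (z : ℂ),
          ((Matrix.GeneralLinearGroup.map (UnitaryGroup.evalC L w) (γH.1.val : GL (Fin 2) (mixedEmbedding.mixedSpace L)) : GL (Fin 2) ℂ) :
              Matrix (Fin 2) (Fin 2) ℂ).charpoly.IsRoot z → ‖z‖ ≤ R := by
  classical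
  -- the continuous majorant `B k = Σ_w (Σ_{i<3} ‖coeff_i (charpoly k_w)‖ + 1)`
  set B : GL (Fin 3) (mixedEmbedding.mixedSpace L) → ℝ := fun k =>
    ∑ w : {w : InfinitePlace L // InfinitePlace.IsComplex w},
      ((∑ i ∈ Finset.range 3,
          ‖((Matrix.GeneralLinearGroup.map (UnitaryGroup.evalC L w) k : GL (Fin 3) ℂ) : Matrix (Fin 3) (Fin 3) ℂ).charpoly.coeff i‖) + 1) with hB
  have hBw : ∀ (w : {w : InfinitePlace L // InfinitePlace.IsComplex w}) (i : ℕ), Continuous fun k : GL (Fin 3) (mixedEmbedding.mixedSpace L) =>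
      ((Matrix.GeneralLinearGroup.map (UnitaryGroup.evalC L w) k : GL (Fin 3) ℂ) : Matrix (Fin 3) (Fin 3) ℂ).charpoly.coeff i := by
    intro w i
    have h1 : Continuous fun k : GL (Fin 3) (mixedEmbedding.mixedSpace L) =>
        ((k : Matrix (Fin 3) (Fin 3) (mixedEmbedding.mixedSpace L)).map (UnitaryGroup.evalC L w)) :=
      Units.continuous_val.matrix_map (UnitaryGroup.continuous_evalC L w)
    exact (Literature.LinearAlgebra.Matrix.continuous_charpoly_coeff i).comp h1
  have hBc : Continuous B := by
    rw [hB]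
    refine continuous_finsetSum _ fun w _ => ?_
    refine Continuous.add (continuous_finsetSum _ fun i _ => (hBw w i).norm) continuous_const
  -- bounded on the compact `K`
  obtain ⟨R, hR⟩ := hK.bddAbove_image hBc.continuousOn
  refine ⟨R, fun γH ⟨k, hkK, hk⟩ w z hz => ?_⟩
  -- `z` is a root of the monic `charpoly k_w`
  have hmonic : ((Matrix.GeneralLinearGroup.map (UnitaryGroup.evalC L w) k : GL (Fin 3) ℂ) : Matrix (Fin 3) (Fin 3) ℂ).charpoly.Monic :=
    Matrix.charpoly_monic _
  have hroot : ((Matrix.GeneralLinearGroup.map (UnitaryGroup.evalC L w) k : GL (Fin 3) ℂ) : Matrix (Fin 3) (Fin 3) ℂ).charpoly.IsRoot z := by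
    rw [charpoly_map_evalC_eq_mul_of_isConj_endoEmbArch L γH hk w, IsRoot.def, eval_mul, hz.eq_zero, zero_mul]
  have hdeg : ((Matrix.GeneralLinearGroup.map (UnitaryGroup.evalC L w) k : GL (Fin 3) ℂ) : Matrix (Fin 3) (Fin 3) ℂ).charpoly.natDegree = 3 := by
    rw [Matrix.charpoly_natDegree_eq_dim, Fintype.card_fin]
  -- Cauchy, then the place-`w` summand is dominated by `B k ≤ R`
  have h1 := norm_le_sum_norm_coeff_add_one_of_isRoot hmonic hroot
  rw [hdeg] at h1
  have h2 : (∑ i ∈ Finset.range 3,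
        ‖((Matrix.GeneralLinearGroup.map (UnitaryGroup.evalC L w) k : GL (Fin 3) ℂ) : Matrix (Fin 3) (Fin 3) ℂ).charpoly.coeff i‖) + 1 ≤ B k := by
    rw [hB]
    exact Finset.single_le_sum (f := fun w : {w : InfinitePlace L // InfinitePlace.IsComplex w} =>
        (∑ i ∈ Finset.range 3,
          ‖((Matrix.GeneralLinearGroup.map (UnitaryGroup.evalC L w) k : GL (Fin 3) ℂ) : Matrix (Fin 3) (Fin 3) ℂ).charpoly.coeff i‖) + 1)
      (fun w' _ => by positivity) (Finset.mem_univ w)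
  exact h1.trans (h2.trans (hR ⟨k, hkK, rfl⟩))

end Arch

end Literature.NumberTheory.Rogawski1990

end
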